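import Mathlib
import Summits.NavierStokesRegularity.NavierStokesRegularity.Theorems.FilamentSkeletonRssSelectionBoxRJRungPicardMap

/-!
# Route `FilamentSkeletonRss` · crux `SelectionBoxRJ` (stmt-NavierStokesRegularity-21220) — rung tools:
# the `C^{2,1}` modulus of a cut-off local-induction arc

Lane `ns-filament-19175-p1` (g7); helper file `--supports stmt-NavierStokesRegularity-21220`, route-independent.

For a `C²` unit-speed solution of the cut-off equation `x″ = c(t) • x′ × (V(x) + f)` (`V(y) = ½y − (21/5)e₃×y`) with
`|c| ≤ η`, `c = 0` for `|t| ≥ S₂`, `c` Lipschitz with constant `L`, and a forcing with `‖f‖ ≤ M` on `|t| ≤ S₂` and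
`‖f u − f v‖ ≤ M′|u − v|` everywhere:

* `cutoff_modulus` — `x″` is Lipschitz on `ℝ`: with `A = (47/10)(‖x 0‖ + S₂) + M` (the bound of `‖V(x)+f‖` on the
  support) `‖x″ u − x″ v‖ ≤ (L·A + η(η·A·A + 47/10 + M′))·|u − v|`.

Together with `cutoff_bending_le` (`‖x″‖ ≤ ηA`) these are the data `κ₀, H` of the quantitative local-induction lemma
`…RungLiaReduction.nearStraight_liaReduction`.

HONEST FRAMING.  Elementary estimate for the rung ladder of a HYPOTHETICAL filament box; nothing here is a claim about
Navier–Stokes regularity or blow-up.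
-/

set_option linter.dupNamespace false -- `Theorems.…Theorems`-style path/namespace repetition is the tree convention

noncomputable section

namespace Summit.NavierStokesRegularity.NavierStokesRegularity.Theorems

open Set Function Filter MeasureTheory Real
open Literature.Analysis.FluidPDE
open scoped InnerProductSpace Topology

namespace SelectionBoxRJRung

/-- Bilinear telescoping for the cross product. [folklore] -/
theorem cross_sub_cross (a b p q : EuclideanSpace ℝ (Fin 3)) :
    cross a p - cross b q = cross (a - b) p + cross b (p - q) := by
  have h1 : cross (a - b) p = cross a p - cross b p := by
    rw [← crossCLM_apply, ← crossCLM_apply a p, ← crossCLM_apply b p, map_sub]; rfl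
  have h2 : cross b (p - q) = cross b p - cross b q := by
    rw [← crossCLM_apply, ← crossCLM_apply b p, ← crossCLM_apply b q, map_sub]
  rw [h1, h2]; abel

/-- The drift `V(y) = ½y − (21/5)e₃×y` is `47/10`-Lipschitz. [folklore] -/
theorem drift_sub_le (y₁ y₂ : EuclideanSpace ℝ (Fin 3)) :
    ‖((1 / 2 : ℝ) • y₁ - (21 / 5 : ℝ) • cross (EuclideanSpace.single 2 1) y₁) -
        ((1 / 2 : ℝ) • y₂ - (21 / 5 : ℝ) • cross (EuclideanSpace.single 2 1) y₂)‖ ≤ 47 / 10 * ‖y₁ - y₂‖ := by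
  have he3 : ‖(EuclideanSpace.single (2 : Fin 3) (1 : ℝ) : EuclideanSpace ℝ (Fin 3))‖ = 1 := by simp
  have hc : cross (EuclideanSpace.single 2 1) y₁ - cross (EuclideanSpace.single 2 1) y₂ =
      cross (EuclideanSpace.single (2 : Fin 3) (1 : ℝ)) (y₁ - y₂) := by
    rw [← crossCLM_apply, ← crossCLM_apply, ← crossCLM_apply, map_sub]
  have hsplit : ((1 / 2 : ℝ) • y₁ - (21 / 5 : ℝ) • cross (EuclideanSpace.single 2 1) y₁) -
      ((1 / 2 : ℝ) • y₂ - (21 / 5 : ℝ) • cross (EuclideanSpace.single 2 1) y₂) =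
      (1 / 2 : ℝ) • (y₁ - y₂) - (21 / 5 : ℝ) • cross (EuclideanSpace.single (2 : Fin 3) (1 : ℝ)) (y₁ - y₂) := by
    rw [← hc, smul_sub, smul_sub]; abel
  rw [hsplit]
  have h1 : ‖(1 / 2 : ℝ) • (y₁ - y₂)‖ = 1 / 2 * ‖y₁ - y₂‖ := by
    rw [norm_smul, Real.norm_eq_abs, abs_of_pos (by norm_num : (0:ℝ) < 1 / 2)]
  have h2 : ‖(21 / 5 : ℝ) • cross (EuclideanSpace.single (2 : Fin 3) (1 : ℝ)) (y₁ - y₂)‖ ≤ 21 / 5 * ‖y₁ - y₂‖ := by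
    rw [norm_smul, Real.norm_eq_abs, abs_of_pos (by norm_num : (0:ℝ) < 21 / 5)]
    refine mul_le_mul_of_nonneg_left ?_ (by norm_num)
    calc _ ≤ ‖(EuclideanSpace.single (2 : Fin 3) (1 : ℝ) : EuclideanSpace ℝ (Fin 3))‖ * ‖y₁ - y₂‖ :=
          norm_cross_le_norm_mul_norm _ _
      _ = ‖y₁ - y₂‖ := by rw [he3, one_mul]
  calc _ ≤ ‖(1 / 2 : ℝ) • (y₁ - y₂)‖ + ‖(21 / 5 : ℝ) • cross (EuclideanSpace.single (2 : Fin 3) (1 : ℝ)) (y₁ - y₂)‖ :=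
        norm_sub_le _ _
    _ ≤ 1 / 2 * ‖y₁ - y₂‖ + 21 / 5 * ‖y₁ - y₂‖ := by rw [h1]; exact add_le_add le_rfl h2
    _ = 47 / 10 * ‖y₁ - y₂‖ := by ring

/-- **The `C^{2,1}` modulus of a cut-off local-induction arc.**  See the module docstring. [folklore] -/
theorem cutoff_modulus {η S₂ M M' L : ℝ} {c : ℝ → ℝ} {f x : ℝ → EuclideanSpace ℝ (Fin 3)} (hη : 0 ≤ η) (hS₂ : 0 < S₂)
    (hM : 0 ≤ M) (hM' : 0 ≤ M') (hL : 0 ≤ L) (hx : ContDiff ℝ 2 x) (hunit : ∀ t, ‖deriv x t‖ = 1)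
    (hode : ∀ t, iteratedDeriv 2 x t = c t • cross (deriv x t)
      ((1 / 2 : ℝ) • x t - (21 / 5 : ℝ) • cross (EuclideanSpace.single 2 1) (x t) + f t))
    (hc : ∀ t, |c t| ≤ η) (hc0 : ∀ t, S₂ ≤ |t| → c t = 0) (hcL : ∀ u v, |c u - c v| ≤ L * |u - v|)
    (hf : ∀ t, |t| ≤ S₂ → ‖f t‖ ≤ M) (hfL : ∀ u v, ‖f u - f v‖ ≤ M' * |u - v|) :
    ∀ u v, ‖deriv (deriv x) u - deriv (deriv x) v‖ ≤
      (L * ((47 / 10) * (‖x 0‖ + S₂) + M) + η * (η * ((47 / 10) * (‖x 0‖ + S₂) + M) * ((47 / 10) * (‖x 0‖ + S₂) + M) +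
        (47 / 10 + M'))) * |u - v| := by
  have hxd : Differentiable ℝ x := hx.differentiable (by norm_num)
  have hTd : Differentiable ℝ (deriv x) := hx.differentiable_deriv_two
  have h2 : iteratedDeriv 2 x = deriv (deriv x) := by rw [iteratedDeriv_succ, iteratedDeriv_one]
  obtain ⟨harm, hcurv, -⟩ := cutoff_bending_le hη hS₂ hM hx hunit hode hc hc0 hf
  -- abbreviations (opaque)
  obtain ⟨A, hA⟩ : ∃ A : ℝ, A = (47 / 10) * (‖x 0‖ + S₂) + M := ⟨_, rfl⟩
  rw [← hA] at hcurv ⊢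
  have hA0 : 0 ≤ A := by rw [hA]; positivity
  set q : ℝ → EuclideanSpace ℝ (Fin 3) := fun t =>
    (1 / 2 : ℝ) • x t - (21 / 5 : ℝ) • cross (EuclideanSpace.single 2 1) (x t) + f t with hq
  have hode' : ∀ t, deriv (deriv x) t = c t • cross (deriv x t) (q t) := fun t => by
    rw [← congrFun h2 t, hode t]
  -- size of `q` on the support, Lipschitz bounds of the factors
  have hpos : ∀ s, ‖x s‖ ≤ ‖x 0‖ + |s| := fun s => liaModel_position_bound hxd hunit s
  have hqA : ∀ t, |t| ≤ S₂ → ‖q t‖ ≤ A := by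
    intro t ht
    have he3 : ‖(EuclideanSpace.single (2 : Fin 3) (1 : ℝ) : EuclideanSpace ℝ (Fin 3))‖ = 1 := by simp
    have h1 : ‖(1 / 2 : ℝ) • x t‖ = 1 / 2 * ‖x t‖ := by
      rw [norm_smul, Real.norm_eq_abs, abs_of_pos (by norm_num : (0:ℝ) < 1 / 2)]
    have h2' : ‖(21 / 5 : ℝ) • cross (EuclideanSpace.single (2 : Fin 3) (1 : ℝ)) (x t)‖ ≤ 21 / 5 * ‖x t‖ := by
      rw [norm_smul, Real.norm_eq_abs, abs_of_pos (by norm_num : (0:ℝ) < 21 / 5)]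
      refine mul_le_mul_of_nonneg_left ?_ (by norm_num)
      calc _ ≤ ‖(EuclideanSpace.single (2 : Fin 3) (1 : ℝ) : EuclideanSpace ℝ (Fin 3))‖ * ‖x t‖ :=
            norm_cross_le_norm_mul_norm _ _
        _ = ‖x t‖ := by rw [he3, one_mul]
    have h3 := norm_add_le ((1 / 2 : ℝ) • x t - (21 / 5 : ℝ) • cross (EuclideanSpace.single 2 1) (x t)) (f t)
    have h4 := norm_sub_le ((1 / 2 : ℝ) • x t) ((21 / 5 : ℝ) • cross (EuclideanSpace.single (2 : Fin 3) (1 : ℝ)) (x t))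
    have h5 := hf t ht
    have h6 := hpos t
    rw [hA]
    show ‖(1 / 2 : ℝ) • x t - (21 / 5 : ℝ) • cross (EuclideanSpace.single 2 1) (x t) + f t‖ ≤ _
    nlinarith [h1, h2', h3, h4, h5, h6, ht, norm_nonneg (x t)]
  have hTL : ∀ u v, ‖deriv x u - deriv x v‖ ≤ η * A * |u - v| := by
    intro u v
    have h := Convex.norm_image_sub_le_of_norm_deriv_le (f := deriv x) (fun w _ => hTd w)
      (fun w _ => by rw [← congrFun h2 w]; exact hcurv w) convex_univ (mem_univ v) (mem_univ u)
    rw [Real.norm_eq_abs] at h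
    exact h
  have hxL : ∀ u v, ‖x u - x v‖ ≤ |u - v| := by
    intro u v
    have h := Convex.norm_image_sub_le_of_norm_deriv_le (f := x) (fun w _ => hxd w) (fun w _ => (hunit w).le)
      convex_univ (mem_univ v) (mem_univ u)
    rw [one_mul, Real.norm_eq_abs] at h
    exact h
  have hqL : ∀ u v, ‖q u - q v‖ ≤ (47 / 10 + M') * |u - v| := by
    intro u v
    have hsplit : q u - q v = (((1 / 2 : ℝ) • x u - (21 / 5 : ℝ) • cross (EuclideanSpace.single 2 1) (x u)) -
        ((1 / 2 : ℝ) • x v - (21 / 5 : ℝ) • cross (EuclideanSpace.single 2 1) (x v))) + (f u - f v) := by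
      simp only [hq]; abel
    rw [hsplit]
    calc _ ≤ ‖((1 / 2 : ℝ) • x u - (21 / 5 : ℝ) • cross (EuclideanSpace.single 2 1) (x u)) -
          ((1 / 2 : ℝ) • x v - (21 / 5 : ℝ) • cross (EuclideanSpace.single 2 1) (x v))‖ + ‖f u - f v‖ := norm_add_le _ _
      _ ≤ 47 / 10 * ‖x u - x v‖ + M' * |u - v| := add_le_add (drift_sub_le _ _) (hfL u v)
      _ ≤ 47 / 10 * |u - v| + M' * |u - v| := by nlinarith [hxL u v]
      _ = (47 / 10 + M') * |u - v| := by ring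
  -- the key one-sided estimate: `v` inside the support
  have hH0 : 0 ≤ L * A + η * (η * A * A + (47 / 10 + M')) := by positivity
  have key : ∀ u v, |v| ≤ S₂ → ‖deriv (deriv x) u - deriv (deriv x) v‖ ≤
      (L * A + η * (η * A * A + (47 / 10 + M'))) * |u - v| := by
    intro u v hv
    have huv := abs_nonneg (u - v)
    have hTv : ‖cross (deriv x v) (q v)‖ ≤ A := by
      calc _ ≤ ‖deriv x v‖ * ‖q v‖ := norm_cross_le_norm_mul_norm _ _
        _ ≤ 1 * A := by rw [hunit v]; exact mul_le_mul_of_nonneg_left (hqA v hv) zero_le_one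
        _ = A := one_mul A
    rcases le_or_gt S₂ |u| with hu | hu
    · -- `u` outside: `x″ u = 0`
      rw [← congrFun h2 u, harm u hu, zero_sub, norm_neg, hode' v, norm_smul, Real.norm_eq_abs]
      have hcv : |c v| ≤ L * |u - v| := by
        have := hcL u v; rwa [hc0 u hu, zero_sub, abs_neg] at this
      calc |c v| * ‖cross (deriv x v) (q v)‖ ≤ L * |u - v| * A := mul_le_mul hcv hTv (norm_nonneg _) (by positivity)
        _ = L * A * |u - v| := by ring
        _ ≤ _ := by
            have h0 : 0 ≤ η * (η * A * A + (47 / 10 + M')) * |u - v| := by positivity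
            linarith [h0]
    · -- both inside
      rw [hode' u, hode' v]
      have hsplit : c u • cross (deriv x u) (q u) - c v • cross (deriv x v) (q v) =
          (c u - c v) • cross (deriv x v) (q v) +
            c u • (cross (deriv x u - deriv x v) (q u) + cross (deriv x v) (q u - q v)) := by
        rw [← cross_sub_cross, sub_smul, smul_sub]; abel
      rw [hsplit]
      have t1 : ‖(c u - c v) • cross (deriv x v) (q v)‖ ≤ L * |u - v| * A := by
        rw [norm_smul, Real.norm_eq_abs]; exact mul_le_mul (hcL u v) hTv (norm_nonneg _) (by positivity)
      have t2 : ‖cross (deriv x u - deriv x v) (q u)‖ ≤ η * A * |u - v| * A := by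
        calc _ ≤ ‖deriv x u - deriv x v‖ * ‖q u‖ := norm_cross_le_norm_mul_norm _ _
          _ ≤ η * A * |u - v| * A := mul_le_mul (hTL u v) (hqA u hu.le) (norm_nonneg _) (by positivity)
      have t3 : ‖cross (deriv x v) (q u - q v)‖ ≤ (47 / 10 + M') * |u - v| := by
        calc _ ≤ ‖deriv x v‖ * ‖q u - q v‖ := norm_cross_le_norm_mul_norm _ _
          _ ≤ 1 * ((47 / 10 + M') * |u - v|) := by
              rw [hunit v]; exact mul_le_mul_of_nonneg_left (hqL u v) zero_le_one
          _ = (47 / 10 + M') * |u - v| := one_mul _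
      have t4 : ‖c u • (cross (deriv x u - deriv x v) (q u) + cross (deriv x v) (q u - q v))‖ ≤
          η * (η * A * |u - v| * A + (47 / 10 + M') * |u - v|) := by
        rw [norm_smul, Real.norm_eq_abs]
        exact mul_le_mul (hc u) ((norm_add_le _ _).trans (add_le_add t2 t3)) (norm_nonneg _) hη
      calc _ ≤ ‖(c u - c v) • cross (deriv x v) (q v)‖ +
            ‖c u • (cross (deriv x u - deriv x v) (q u) + cross (deriv x v) (q u - q v))‖ := norm_add_le _ _
        _ ≤ L * |u - v| * A + η * (η * A * |u - v| * A + (47 / 10 + M') * |u - v|) := add_le_add t1 t4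
        _ = (L * A + η * (η * A * A + (47 / 10 + M'))) * |u - v| := by ring
  intro u v
  rcases le_or_gt |v| S₂ with hv | hv
  · exact key u v hv
  rcases le_or_gt |u| S₂ with hu | hu
  · rw [norm_sub_rev, abs_sub_comm]; exact key v u hu
  · rw [← congrFun h2 u, ← congrFun h2 v, harm u hu.le, harm v hv.le, sub_zero, norm_zero]
    positivity

end SelectionBoxRJRung

end Summit.NavierStokesRegularity.NavierStokesRegularity.Theorems
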